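import Summits.ResolutionOfSingularities.ResolutionOfSingularities.Theorems.MarkedTransferCampaignW46MohWindowShadePSLaws
import Summits.ResolutionOfSingularities.ResolutionOfSingularities.Theorems.MarkedTransferCampaignW46MohWindowShadeDigits
import HarnessLib

/-!
# [OURS · L1 W4.6] Rung (iii) "Moh window", power-series residuals: the RUN FORMULA with explicit digits
  to FINITE HORIZON (polynomials) and for SERIES (proofs only)

Cell `res-hironaka`, rung L, slot W4.6, seat `res-L1-s46-pv-6` (gen 6).  `--kind proof --supports
stmt-ResolutionOfSingularities-16155 --as helper`.  `…MohWindowShadeDigits.formal_pth_power_of_run_digits`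
(`k` consecutive point blow-ups in the chart `y_j` at the points `t_n` make `F₀ ≡ (y_i − Σ_{n<k} t_n y_j^{n+1})^p·w`
modulo degree `≥ o + k`) asks its degree hypothesis at EVERY stage of an infinite polynomial walk; the shadow walk
of a series walk (`…PSLaws.shadow`) is faithful only to finite horizon, so §1 re-proves the run formula with the
hypotheses restricted to the stages `< k` / `≤ k` actually used (`run_formula_digits_fin`,
`digits_support_bound_fin`, `formal_pth_power_of_run_digits_fin`; same proofs), and §2 transfers it to series
walks (`Series.formal_pth_power_of_run_digits`).  OURS; NOT a statement of the manuscript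
[claim: Hironaka2017, status: under-review], nothing of which is used.  AI review is weaker than expert review.
-/

noncomputable section

set_option linter.dupNamespace false -- mandated namespace of this single-conjunct summit

open MvPolynomial Finset

namespace Summit.ResolutionOfSingularities.ResolutionOfSingularities.Theorems.CampaignW46.MohWindowShadePS

open Literature.AlgebraicGeometry.Resolution
open Literature.AlgebraicGeometry.Resolution.PointBlowup
open Literature.AlgebraicGeometry.Resolution.Hauser2010
open Literature.Barriers.ResolutionOfSingularities (ordZero_le_of_coeff_ne_zero le_ordZero_of_forall)
open MohWindowShadeCleaning
open MohWindowShadeRunFormula (aeval_run_eq aeval_monomialSubst_eq_sum eq_of_add_single_eq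
  exists_cofactor_of_support_bound)
open MohWindowShadeDigits (aeval_digits coeff_zero_digits)

variable {σ : Type*} {K : Type*} [Field K] [Fintype σ] [DecidableEq σ] [DecidableEq K]
variable (p : ℕ) [hp : Fact p.Prime] [CharP K p]

section TwoLetters

variable {j i : σ}

/-! ## §1 The run formula to finite horizon (polynomials) -/

/-- **[OURS · L1 W4.6] THE RUN FORMULA WITH EXPLICIT DIGITS, finite horizon** (`…Digits.run_formula_digits` with
the degree hypothesis only at the stages `< k`): `F_k · y_j^{pk} + D = F₀(y_j, y_j^k·y_i + ψ_k(y_j))`,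
`ψ_k = Σ_{n<k} (b n i)·y_j^{n+1}`, `D` `p`-th-power-supported.  NOT a statement of the manuscript. [folklore] -/
theorem run_formula_digits_fin (hij : i ≠ j) (htwo : ∀ l, l = j ∨ l = i) (s : ℕ → State σ K)
    (b : ℕ → σ → K) (hb : ∀ n, b n j = 0) (hstep : ∀ n, s (n + 1) = step p j (b n) (s n)) (k : ℕ)
    (hdeg : ∀ n, n < k → ∀ d ∈ (s n).F.support, p ≤ d.degree) :
    ∃ D : MvPolynomial σ K, (∀ d ∈ D.support, IsPthPowerExponent p d) ∧
      (s k).F * X j ^ (p * k) + D =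
        aeval (fun l => if l = j then X j else
          X j ^ k * X l + ∑ n ∈ Finset.range k, C (b n i) * X j ^ (n + 1)) (s 0).F := by
  induction k with
  | zero =>
    refine ⟨0, fun d hd => by simp at hd, ?_⟩
    have hid : (fun l => if l = j then X j else
        X j ^ 0 * X l + ∑ n ∈ Finset.range 0, C (b n i) * X j ^ (n + 1) : σ → MvPolynomial σ K) = X := by
      funext l
      split_ifs with h
      · rw [h]
      · rw [pow_zero, one_mul, Finset.sum_range_zero, add_zero]
    rw [hid, aeval_X_left_apply, mul_zero, pow_zero, mul_one, add_zero]
  | succ k ih =>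
    obtain ⟨D, hD, hrun⟩ := ih fun n hn => hdeg n (by omega)
    obtain ⟨D₁, hD₁, hone⟩ := exists_step_mul_X_pow_add p hij htwo (b k) (hb k) (s k)
      (hdeg k (Nat.lt_succ_self k))
    set fb : σ → MvPolynomial σ K := fun l => if l = j then X j else (X l + C (b k l)) * X j with hfb
    have hfbj : fb j = X j := by rw [hfb]; exact if_pos rfl
    have hfbi : fb i = (X i + C (b k i)) * X j := by rw [hfb]; exact if_neg hij
    refine ⟨aeval fb D + D₁ * X j ^ (p * k), forall_support_add p (forall_support_aeval p fb hD)
        (forall_support_mul p hD₁ (forall_support_pow_mul p (X j) k)), ?_⟩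
    have hcomp : (fun l => aeval fb ((fun l => if l = j then X j else
          X j ^ k * X l + ∑ n ∈ Finset.range k, C (b n i) * X j ^ (n + 1)) l))
        = fun l => if l = j then X j else
          X j ^ (k + 1) * X l + ∑ n ∈ Finset.range (k + 1), C (b n i) * X j ^ (n + 1) := by
      funext l
      by_cases hl : l = j
      · simp only [hl, if_true]
        rw [aeval_X, hfbj]
      · have hli : l = i := by rcases htwo l with h | h; exacts [absurd h hl, h]
        simp only [hl, if_false]
        rw [map_add, map_mul, map_pow, aeval_X, aeval_X, hfbj, aeval_digits (j := j) fb hfbj, hli, hfbi,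
          Finset.sum_range_succ]
        ring
    rw [hstep k, ← hcomp, ← comp_aeval_apply, ← hrun, map_add, map_mul, map_pow, aeval_X, hfbj,
      ← hone, mul_add p k 1, mul_one, pow_add]
    ring

/-- **[OURS · L1 W4.6] THE SUPPORT OF THE DIGIT EXPANSION, finite horizon** (`…Digits.digits_support_bound` with the
degree hypothesis only at the stages `< k`): from a cleaned start, if every monomial of `F_k` has degree `≥ o`,
every monomial `y^e` of `clean(F₀(y_j, y_i + ψ_k(y_j)))` satisfies `o + pk ≤ e_j + (k+1)·e_i`.  NOT a statement of
the manuscript. [folklore] -/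
theorem digits_support_bound_fin (hij : i ≠ j) (htwo : ∀ l, l = j ∨ l = i) (s : ℕ → State σ K)
    (b : ℕ → σ → K) (hb : ∀ n, b n j = 0) (hstep : ∀ n, s (n + 1) = step p j (b n) (s n))
    (hclean : deletePthPowers p (s 0).F = (s 0).F) (k : ℕ)
    (hdeg : ∀ n, n < k → ∀ d ∈ (s n).F.support, p ≤ d.degree) {o : ℕ}
    (ho : ∀ d ∈ (s k).F.support, o ≤ d.degree) :
    ∀ e ∈ (deletePthPowers p (aeval (fun l => if l = j then X j else
        X l + ∑ n ∈ Finset.range k, C (b n i) * X j ^ (n + 1)) (s 0).F)).support,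
      o + p * k ≤ e j + (k + 1) * e i := by
  classical
  obtain ⟨D, hD, hrun⟩ := run_formula_digits_fin p hij htwo s b hb hstep k hdeg
  set ψ : MvPolynomial σ K := ∑ n ∈ Finset.range k, C (b n i) * X j ^ (n + 1) with hψ
  have hψf : ∀ f : σ → MvPolynomial σ K, f j = X j → aeval f ψ = ψ := fun f hf => aeval_digits f hf _ k
  have hcleank : deletePthPowers p (s k).F = (s k).F := by
    rcases k with _ | k
    · exact hclean
    · rw [hstep k]; exact deletePthPowers_step p j (b k) (s k)
  set τ : σ → MvPolynomial σ K := fun l => if l = j then X j else X l + ψ with hτ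
  set Hk : σ → MvPolynomial σ K := fun l => if l = j then X j else X j ^ k * X l with hHk
  set Q := deletePthPowers p (aeval τ (s 0).F) with hQ
  have hQclean : ∀ d ∈ (aeval Hk Q).support, ¬ IsPthPowerExponent p d := by
    intro d hd hPd
    rw [hHk, aeval_monomialSubst_eq_sum hij htwo k Q] at hd
    obtain ⟨e, he, -, rfl⟩ := exists_of_mem_support_sum_monomial _ _ _ hd
    have hQe : ¬ IsPthPowerExponent p e :=
      not_isPthPowerExponent_of_clean p (deletePthPowers_deletePthPowers p _) he
    apply hQe
    rw [isPthPowerExponent_iff] at hPd ⊢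
    have hi' := hPd i
    have hj' := hPd j
    simp only [Finsupp.add_apply, Finsupp.single_apply, if_true, if_neg hij.symm, add_zero] at hi' hj'
    intro l
    rcases htwo l with rfl | rfl
    · exact (Nat.dvd_add_left (Dvd.dvd.mul_left hi' k)).mp hj'
    · exact hi'
  have hFk : (s k).F * X j ^ (p * k) = aeval Hk Q := by
    have h1 : aeval τ (s 0).F = Q + (aeval τ (s 0).F - Q) := by ring
    have hC₁ := forall_support_sub_deletePthPowers p (aeval τ (s 0).F)
    rw [aeval_run_eq hψf k, ← hHk, ← hτ, h1, map_add] at hrun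
    have h2 := congrArg (deletePthPowers p) hrun
    rw [deletePthPowers_add_of_forall p _ hD, deletePthPowers_mul_X_pow, hcleank,
      deletePthPowers_add_of_forall p _ (forall_support_aeval p Hk hC₁),
      deletePthPowers_eq_self_of_forall p hQclean] at h2
    exact h2
  intro e he
  have hcoeff : coeff (e + Finsupp.single j (k * e i)) (aeval Hk Q) = coeff e Q := by
    rw [hHk, aeval_monomialSubst_eq_sum hij htwo k Q]
    exact coeff_sum_monomial_of_injOn Q.support _ _ he
      (fun e' _ _ h => eq_of_add_single_eq hij htwo k h)
  have hmem : coeff (e + Finsupp.single j (k * e i)) ((s k).F * X j ^ (p * k)) ≠ 0 := by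
    rw [hFk, hcoeff]; exact MvPolynomial.mem_support_iff.mp he
  rw [X_pow_eq_monomial, coeff_mul_monomial'] at hmem
  split_ifs at hmem with hle
  · rw [mul_one] at hmem
    have hd := ho _ (MvPolynomial.mem_support_iff.mpr hmem)
    have h3 : (e + Finsupp.single j (k * e i) - Finsupp.single j (p * k)).degree
        + (Finsupp.single j (p * k)).degree = (e + Finsupp.single j (k * e i)).degree := by
      rw [← map_add, tsub_add_cancel_of_le hle]
    rw [map_add, Finsupp.degree_single, Finsupp.degree_single, degree_eq_add hij htwo e] at h3
    have h4 : (k + 1) * e i = k * e i + e i := by ring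
    omega
  · exact absurd rfl hmem

/-- **[OURS · L1 W4.6] A STALL PHASE IS THE DIGIT EXPANSION OF A CANONICAL FORMAL `p`-FOLD BRANCH, finite
horizon** (`…Digits.formal_pth_power_of_run_digits` with the degree hypothesis only at the stages `< k`):
`F₀ ≡ (y_i − Σ_{n<k} t_n y_j^{n+1})^p · w` modulo monomials of degree `≥ o + k`.  NOT a statement of the
manuscript. [folklore] -/
theorem formal_pth_power_of_run_digits_fin (hij : i ≠ j) (htwo : ∀ l, l = j ∨ l = i) (s : ℕ → State σ K)
    (b : ℕ → σ → K) (hb : ∀ n, b n j = 0) (hstep : ∀ n, s (n + 1) = step p j (b n) (s n))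
    (hclean : deletePthPowers p (s 0).F = (s 0).F) (k : ℕ)
    (hdeg : ∀ n, n < k → ∀ d ∈ (s n).F.support, p ≤ d.degree) {o : ℕ}
    (ho : ∀ d ∈ (s k).F.support, o ≤ d.degree) :
    ∃ w : MvPolynomial σ K, ((o + k : ℕ) : ℕ∞) ≤
      ordZero ((s 0).F - (X i - ∑ n ∈ Finset.range k, C (b n i) * X j ^ (n + 1)) ^ p * w) :=
  exists_cofactor_of_support_bound p hij htwo hclean (fun f hf => aeval_digits f hf _ k)
    (coeff_zero_digits _ k) (digits_support_bound_fin p hij htwo s b hb hstep hclean k hdeg ho)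

/-! ## §2 The run formula for series walks -/

/-- **[OURS · L1 W4.6] A STALL PHASE OF A SERIES WALK IS THE DIGIT EXPANSION OF A CANONICAL FORMAL `p`-FOLD
BRANCH.**  Let `S_{n+1} = step p j (b n) (S n)` be consecutive point blow-ups of `x^p + F(y_j, y_i)`, `F ∈ K⟦y⟧`,
read in the chart `y_j` at the points `t_n = b n i`, from a cleaned series state, all residual series of order in
`[p, 2p)`.  If the `k`-th residual series has order `o`, then `F₀ ≡ (y_i − Σ_{n<k} t_n y_j^{n+1})^p · w` modulo
degree `≥ o + k` for a polynomial cofactor `w` (the finite-horizon run formula on the shadow walk of depth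
`o + k + (k+2)p`).  NOT a statement of the manuscript. [folklore] -/
theorem Series.formal_pth_power_of_run_digits (hij : i ≠ j) (htwo : ∀ l, l = j ∨ l = i)
    (S : ℕ → Series σ K) (b : ℕ → σ → K) (hb : ∀ n, b n j = 0)
    (hstep : ∀ n, S (n + 1) = (S n).step p j (b n)) (hclean : IsClean p (S 0).F)
    (hwin : ∀ n, ∃ o : ℕ, (S n).F.order = o ∧ p ≤ o ∧ o < 2 * p) (k : ℕ) {o : ℕ}
    (ho : (S k).F.order = o) :
    ∃ w : MvPolynomial σ K, ((o + k : ℕ) : ℕ∞) ≤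
      ((S 0).F - (((X i - ∑ n ∈ Finset.range k, C (b n i) * X j ^ (n + 1)) ^ p * w :
        MvPolynomial σ K) : MvPowerSeries σ K)).order := by
  classical
  set M := o + k + (k + 2) * p with hM
  set t : ℕ → State σ K := shadow p (S 0) M (fun _ => j) b with ht
  -- agreement of the shadow walk with the series walk up to stage `k`
  have hA : ∀ n, n ≤ k → Agree (M - n * p) (t n) (S n) := by
    intro n hn
    refine agree_shadow p S (fun _ => j) b hb hstep M n fun m hm => ?_
    obtain ⟨o', ho', -, ho'2⟩ := hwin m
    refine ⟨o', ho', ?_⟩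
    have h1 : m * p + 2 * p ≤ (k + 2) * p := by nlinarith
    omega
  -- the degree hypotheses of the finite-horizon run formula on the shadow walk
  have hdegn : ∀ n, n ≤ k → ∀ d ∈ (t n).F.support, (S n).F.order.toNat ≤ d.degree ∧ p ≤ d.degree := by
    intro n hn d hd
    obtain ⟨o', ho', hpo', ho'2⟩ := hwin n
    rw [ho', ENat.toNat_coe]
    have h1 : n * p + 2 * p ≤ (k + 2) * p := by nlinarith
    by_cases hdM : d.degree < M - n * p
    · have h := (S n).le_degree_of_order_eq ho' d (((hA n hn).mem_support_iff hdM).mp hd)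
      exact ⟨h, le_trans hpo' h⟩
    · push Not at hdM
      constructor <;> omega
  obtain ⟨w, hw⟩ := formal_pth_power_of_run_digits_fin p hij htwo t b hb
    (fun n => shadow_succ p (S 0) M (fun _ => j) b n) (hclean.deletePthPowers_truncTot M) k
    (fun n hn d hd => (hdegn n hn.le d hd).2) (o := o)
    (fun d hd => by have h := (hdegn k le_rfl d hd).1; rw [ho, ENat.toNat_coe] at h; exact h)
  refine ⟨w, MvPowerSeries.nat_le_order fun e he => ?_⟩
  have heM : e.degree < M := by omega
  have he' : (e.degree : ℕ∞) < ((o + k : ℕ) : ℕ∞) := by exact_mod_cast he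
  have h0 : coeff e ((t 0).F - (X i - ∑ n ∈ Finset.range k, C (b n i) * X j ^ (n + 1)) ^ p * w) = 0 := by
    by_contra hne
    exact absurd (lt_of_lt_of_le he' hw) (not_lt.mpr (ordZero_le_of_coeff_ne_zero _ _ hne))
  have ht0 : coeff e (t 0).F = MvPowerSeries.coeff e (S 0).F := (agree_trunc M (S 0)).1 e heM
  rw [MvPolynomial.coeff_sub, ht0] at h0
  rw [map_sub, MvPolynomial.coeff_coe]
  exact h0

end TwoLetters

end Summit.ResolutionOfSingularities.ResolutionOfSingularities.Theorems.CampaignW46.MohWindowShadePS
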